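import Mathlib
import Literature.NumberTheory.LFunctions.Zhang2022.Section12EpsFlow
import Literature.NumberTheory.LFunctions.Zhang2022.Section12Ded1217
import Literature.NumberTheory.LFunctions.Zhang2022.SkeletonEvalRel
import HarnessLib

/-!
# Zhang (2022) §12: (12.17) from the range evaluations of `Θ₁(𝐚₁₂,𝐚₂₅)`, `Θ₁(𝐚₁₅,𝐚₂₂)` — the assembler,
# GENERIC in the two top-range main terms (both currencies: `Eval1217` and `Eval1217Rel`)

Topic `Literature/NumberTheory/LFunctions/Zhang2022` (Landau–Siegel audit tree; verdict-neutral).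
Y. Zhang, *Discrete mean estimates and the Landau–Siegel zero*, arXiv:2211.02515v1 (2022)
[Zhang2022LandauSiegel]. **Status of the source: an unrefereed manuscript under adjudication** (campaign D-0069;
ZHANG-L discharge lane, WP12, re-type of record RT-02 / R-18 / R-25). Everything in this file is PROVED (theorems
only; no new definitions, no new named facts; standard axioms); nothing here is a claim about Theorems 1–2 of
the source or about Landau–Siegel zeros.

**What.** "Finally, by (12.9), (12.15) and (12.16) we conclude `Ξ₁₅ = (e₁* + 2e₂* + ε)𝔞𝔓` (12.17)" (p. 73,
tex L3713). The lane's re-type RT-02 replaces the v19 leaves (12.14)/(12.15)/§12.u049 (whose printed roundings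
descend from the refuted pointwise bounds of Lemmas 12.1/12.3) by the two TOP-RANGE evaluations of
`S_j(𝐚₁₂,𝐚₂₅)`, `S_j(𝐚₁₅,𝐚₂₂)` with the manuscript's own window functions kept exact (`Typed.Sec12C.Top1225Ex`,
`Top1522Ex`) and ONE window-value node (`Typed.Sec12C.Win1217Ex`). This file proves the ASSEMBLER behind that
re-type ONCE, GENERICALLY in the two top-range main-term families
`M₂₅, M₂₂ : (D : ℕ) → DirichletCharacter ℂ D → ℕ → ℂ` (so that it instantiates by `exact` to the typed nodes —
companion file `Section12Eval1217Exact` — and equally to any later reading of the windows):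

* `weighted1225_of_top` — **(12.15)-shape**: from (12.12) (`Eq1212`, second form), the middle range `o(α)`
  (`Mid1225`) and a top-range claim `‖S_j|_{top} − M₂₅(j)‖ ≤ εα`,
  `‖(2α)⁻¹S₁ + 2α⁻¹S₂ + (3/2α)S₃ (𝐚₁₂,𝐚₂₅) − (𝔞e₁* + Σ_j (w_j/α)M₂₅(j))‖ ≤ ε` eventually (the `e₁*`-algebra of
  (2.13) is EXACT, `Sec12D.weighted_main1212_eq`, remainder `O(𝔞𝓛⁻⁸) = o(1)`);
* `weighted1522_of_top` — **(12.16)-shape**: from "first sum `o(α)`" (`Low1522`) and a top-range claim,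
  `‖Σ_j (w_j/α)S_j(𝐚₁₅,𝐚₂₂) − Σ_j (w_j/α)M₂₂(j)‖ ≤ ε` eventually;
* `ecal_a12_small_of_top`, `ecal_a15_small_of_top` — the TACIT inputs `E(𝐚₁₂,𝐚₂₅), E(𝐚₁₅,𝐚₂₂) = o(𝔓)` of "by
  Proposition 7.1", from the same range claims plus a size bound `‖M(j)‖ ≤ Kα(𝔞+1)` (pattern
  `Sec12D.ecal_a12_small`; only `‖main‖ = O(α(𝔞+1))` is used);
* `xi15_assembly_pt` — the pointwise `ε/8`-bookkeeping of (12.9) + Prop. 7.1 + the two weighted sums + the window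
  value (pattern `Sec12D.eval1217_core`), with a weight `w ∈ {1, 𝔞+1}` serving both currencies;
* **`eval1217_of_top_ranges`** — `Prop71 → Eq129 → Eq1212 → Mid1225 → (top 𝐚₂₅) → Low1522 → (top 𝐚₂₂) →
  (sizes) → (window value `‖Σ_j(w_j/α)M₂₅ + conj Σ_j(w_j/α)M₂₂ − 2𝔞e₂*‖ ≤ κ𝔞 + ε`, `κ ≤ 10⁻⁵`) → Skeleton.Eval1217`
  (R-18 currency), and **`eval1217Rel_of_top_ranges`** — the same with the RELATIVE (12.9)
  (`‖Ξ₁₅ − (Θ₁ + conj Θ₁)‖ ≤ ε(𝔞+1)𝔓`, as `Sec12D.eq129_rel_of_xi15_rel` supplies it) and window slack `ε(𝔞+1)`,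
  concluding `Skeleton.Eval1217Rel` (R-25 currency of record).

No §12 CLAIM node is asserted here: every range claim, size bound and window value is a HYPOTHESIS of the
stated shape. Instantiation at the typed nodes `Top1225Ex/Top1522Ex/Win1217Ex` (`κ = 5·10⁻⁶`; size bounds of
the exact windows proved there) is the companion file.

## References

* Y. Zhang, arXiv:2211.02515v1 (2022), §12 pp. 71–73, (12.12)–(12.17), tex L3600–L3720; §7 Prop. 7.1 p. 33;
  (2.10), (2.13), (2.31). [cite: Zhang2022LandauSiegel, §12 (12.15)–(12.17)]
-/

noncomputable section

open Complex Real ComplexConjugate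
open Literature.NumberTheory.LFunctions.Zhang2022
open Literature.NumberTheory.LFunctions.Zhang2022.Skeleton
open Literature.NumberTheory.LFunctions.Zhang2022.Typed.Sec12A
open Literature.NumberTheory.LFunctions.Zhang2022.Typed.Sec12C

namespace Literature.NumberTheory.LFunctions.Zhang2022.Sec12D

/-! ## Linear bookkeeping -/

section Bookkeeping

/-- The linear bookkeeping of "low + middle + top ⇒ weighted sum" with PER-`j` top main terms `t_j`: if
`S_j = L_j + M_j + T_j`, `‖L_j − m_j‖, ‖M_j‖, ‖T_j − t_j‖ ≤ ε₁α` and `Σ_j (w_j/α)m_j = E₁ + R`, then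
`‖Σ_j (w_j/α)S_j − (E₁ + Σ_j (w_j/α)t_j)‖ ≤ 12ε₁ + ‖R‖` (`w = ½, 2, 3/2`). [cite: Zhang2022LandauSiegel, §12 (12.15) p.72] -/
theorem weighted_sum_top {α ε₁ : ℝ} (hα : 0 < α)
    {S1 S2 S3 L1 M1 T1 L2 M2 T2 L3 M3 T3 m1 m2 m3 t1 t2 t3 E1 R : ℂ}
    (hS1 : S1 = L1 + M1 + T1) (hS2 : S2 = L2 + M2 + T2) (hS3 : S3 = L3 + M3 + T3)
    (r1L : ‖L1 - m1‖ ≤ ε₁ * α) (r1M : ‖M1‖ ≤ ε₁ * α) (r1T : ‖T1 - t1‖ ≤ ε₁ * α)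
    (r2L : ‖L2 - m2‖ ≤ ε₁ * α) (r2M : ‖M2‖ ≤ ε₁ * α) (r2T : ‖T2 - t2‖ ≤ ε₁ * α)
    (r3L : ‖L3 - m3‖ ≤ ε₁ * α) (r3M : ‖M3‖ ≤ ε₁ * α) (r3T : ‖T3 - t3‖ ≤ ε₁ * α)
    (hmain12 : (1 / (2 * α) * m1 + 2 / α * m2 + 3 / (2 * α) * m3 : ℂ) = E1 + R) :
    ‖(1 / (2 * α) * S1 + 2 / α * S2 + 3 / (2 * α) * S3 : ℂ) -
        (E1 + (1 / (2 * α) * t1 + 2 / α * t2 + 3 / (2 * α) * t3))‖ ≤ 12 * ε₁ + ‖R‖ := by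
  have key : (1 / (2 * α) * S1 + 2 / α * S2 + 3 / (2 * α) * S3 : ℂ) -
        (E1 + (1 / (2 * α) * t1 + 2 / α * t2 + 3 / (2 * α) * t3)) =
      (1 / (2 * α) * ((L1 - m1) + M1 + (T1 - t1)) + 2 / α * ((L2 - m2) + M2 + (T2 - t2)) +
        3 / (2 * α) * ((L3 - m3) + M3 + (T3 - t3)) : ℂ) + R := by
    rw [hS1, hS2, hS3]
    linear_combination hmain12
  rw [key]
  have nα1 : ‖(1 / (2 * α) : ℂ)‖ = 1 / (2 * α) := by
    rw [show (1 / (2 * α) : ℂ) = ((1 / (2 * α) : ℝ) : ℂ) by push_cast; ring,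
      Complex.norm_real, Real.norm_of_nonneg (by positivity)]
  have nα2 : ‖(2 / α : ℂ)‖ = 2 / α := by
    rw [show (2 / α : ℂ) = ((2 / α : ℝ) : ℂ) by push_cast; ring,
      Complex.norm_real, Real.norm_of_nonneg (by positivity)]
  have nα3 : ‖(3 / (2 * α) : ℂ)‖ = 3 / (2 * α) := by
    rw [show (3 / (2 * α) : ℂ) = ((3 / (2 * α) : ℝ) : ℂ) by push_cast; ring,
      Complex.norm_real, Real.norm_of_nonneg (by positivity)]
  have b1 : ‖(L1 - m1) + M1 + (T1 - t1)‖ ≤ 3 * (ε₁ * α) := (norm_add₃_le).trans (by linarith)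
  have b2 : ‖(L2 - m2) + M2 + (T2 - t2)‖ ≤ 3 * (ε₁ * α) := (norm_add₃_le).trans (by linarith)
  have b3 : ‖(L3 - m3) + M3 + (T3 - t3)‖ ≤ 3 * (ε₁ * α) := (norm_add₃_le).trans (by linarith)
  calc ‖(1 / (2 * α) * ((L1 - m1) + M1 + (T1 - t1)) + 2 / α * ((L2 - m2) + M2 + (T2 - t2)) +
          3 / (2 * α) * ((L3 - m3) + M3 + (T3 - t3)) : ℂ) + R‖
      ≤ ‖(1 / (2 * α) * ((L1 - m1) + M1 + (T1 - t1)) + 2 / α * ((L2 - m2) + M2 + (T2 - t2)) +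
          3 / (2 * α) * ((L3 - m3) + M3 + (T3 - t3)) : ℂ)‖ + ‖R‖ := norm_add_le _ _
    _ ≤ (1 / (2 * α) * (3 * (ε₁ * α)) + 2 / α * (3 * (ε₁ * α)) +
          3 / (2 * α) * (3 * (ε₁ * α))) + ‖R‖ := by
        gcongr
        refine (norm_add₃_le).trans ?_
        rw [norm_mul, norm_mul, norm_mul, nα1, nα2, nα3]
        gcongr
    _ = 12 * ε₁ + ‖R‖ := by field_simp; ring

/-- The arithmetic of "`E = 𝔓𝓛²Σ|S_j| = o(𝔓)`" with a general constant term: if `𝔞 ≤ A₀𝓛⁴`, `c, K, A₀ ≥ 0`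
and `𝓛 ≥ π(A₀K + c)/ε` (`𝓛 ≥ 1`), then `(π/𝓛⁷)(𝔞K + c) ≤ ε`. [cite: Zhang2022LandauSiegel, §7 Prop. 7.1 p.33] -/
theorem small_of_log_large' {K A₀ A ℓ ε c : ℝ} (hℓ : 1 ≤ ℓ) (hK : 0 ≤ K) (hc : 0 ≤ c)
    (hA₀ : 0 ≤ A₀) (hAle : A ≤ A₀ * ℓ ^ 4) (hε : 0 < ε) (hb : π * (A₀ * K + c) / ε ≤ ℓ) :
    π / ℓ ^ 7 * (A * K + c) ≤ ε := by
  have hπ := Real.pi_pos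
  have hℓ0 : 0 < ℓ := by linarith
  have h1 : π / ℓ ^ 7 * (A * K + c) ≤ π / ℓ ^ 7 * (A₀ * ℓ ^ 4 * K + c) := by
    gcongr
  have h2 : π / ℓ ^ 7 * (A₀ * ℓ ^ 4 * K + c) ≤ π * (A₀ * K + c) / ℓ := by
    rw [div_mul_eq_mul_div, div_le_div_iff₀ (by positivity) (by positivity)]
    have h5 : ℓ ^ 5 ≤ ℓ ^ 7 := pow_le_pow_right₀ hℓ (by norm_num)
    have h17 : ℓ ^ 1 ≤ ℓ ^ 7 := pow_le_pow_right₀ hℓ (by norm_num)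
    rw [pow_one] at h17
    nlinarith [mul_nonneg (mul_nonneg hπ.le hA₀) hK, mul_nonneg hπ.le hc, hπ]
  have h3 : π * (A₀ * K + c) / ℓ ≤ ε := by
    rw [div_le_iff₀ hℓ0]
    have := (div_le_iff₀ hε).mp hb
    linarith
  linarith

/-- `|C|·(η/(|C|+1)) ≤ η` for `η ≥ 0`. [folklore] -/
private theorem abs_mul_div_succ_le'' (C : ℝ) {η : ℝ} (hη : 0 ≤ η) : |C| * (η / (|C| + 1)) ≤ η := by
  have h1 : 0 < |C| + 1 := by positivity
  rw [mul_div_assoc', div_le_iff₀ h1]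
  nlinarith [abs_nonneg C]

/-- **The pointwise bookkeeping of (12.17)** (pattern `Sec12D.eval1217_core`), with a weight `w ≥ 1`
(`w = 1`: absolute currency; `w = 𝔞 + 1`: relative currency): from (12.9) `‖Ξ − (Θa + conj Θb)‖ ≤ ηw𝔓`,
Proposition 7.1 at the two pairs (`‖Θ − W𝔓‖ ≤ C·E + η𝔓`, `E ≤ (η/(|C|+1))𝔓`), the two weighted-sum
evaluations `‖Wa − (𝔞e₁ + Ma)‖ ≤ ηw`, `‖Wb − Mb‖ ≤ ηw`, and the window value `‖Ma + conj Mb − 2𝔞e₂‖ ≤ κ𝔞 + ηw`: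
`‖Ξ − (e₁ + 2e₂)𝔞𝔓‖ ≤ κ𝔞𝔓 + 8ηw𝔓`. [cite: Zhang2022LandauSiegel, §12 (12.17) p.73] -/
theorem xi15_assembly_pt {Ξ Θa Θb mva mvb Wa Wb Ma Mb E1 E2 : ℂ} {A P Ea Eb C η κ w : ℝ}
    (hP : 0 ≤ P) (hw : 1 ≤ w) (hη : 0 ≤ η) (hEa : 0 ≤ Ea) (hEb : 0 ≤ Eb)
    (r : ‖Ξ - (Θa + conj Θb)‖ ≤ η * w * P)
    (t1 : ‖Θa - mva‖ ≤ C * Ea + η * P) (hmva : mva = Wa * (P : ℂ)) (hEa' : Ea ≤ η / (|C| + 1) * P)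
    (t2 : ‖Θb - mvb‖ ≤ C * Eb + η * P) (hmvb : mvb = Wb * (P : ℂ)) (hEb' : Eb ≤ η / (|C| + 1) * P)
    (c3 : ‖Wa - ((A : ℂ) * E1 + Ma)‖ ≤ η * w) (c4 : ‖Wb - Mb‖ ≤ η * w)
    (win : ‖Ma + conj Mb - 2 * (A : ℂ) * E2‖ ≤ κ * A + η * w) :
    ‖Ξ - (E1 + 2 * E2) * (A : ℂ) * (P : ℂ)‖ ≤ κ * A * P + 8 * η * w * P := by
  have key : Ξ - (E1 + 2 * E2) * (A : ℂ) * (P : ℂ) =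
      (Ξ - (Θa + conj Θb)) + (Θa - mva) + conj (Θb - mvb) +
        (Wa - ((A : ℂ) * E1 + Ma)) * (P : ℂ) + conj (Wb - Mb) * (P : ℂ) +
        (Ma + conj Mb - 2 * (A : ℂ) * E2) * (P : ℂ) := by
    rw [hmva, hmvb]
    simp only [map_sub, map_mul, Complex.conj_ofReal]
    ring
  rw [key]
  set X1 := Ξ - (Θa + conj Θb)
  set X2 := Θa - mva
  set X3 := conj (Θb - mvb)
  set X4 := (Wa - ((A : ℂ) * E1 + Ma)) * (P : ℂ)
  set X5 := conj (Wb - Mb) * (P : ℂ)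
  set X6 := (Ma + conj Mb - 2 * (A : ℂ) * E2) * (P : ℂ)
  have n5 := norm_add_le X1 X2
  have n4 := norm_add_le (X1 + X2) X3
  have n3 := norm_add_le (X1 + X2 + X3) X4
  have n2 := norm_add_le (X1 + X2 + X3 + X4) X5
  have n1 := norm_add_le (X1 + X2 + X3 + X4 + X5) X6
  have e3 : ‖X3‖ = ‖Θb - mvb‖ := Complex.norm_conj _
  have e4 : ‖X4‖ = ‖Wa - ((A : ℂ) * E1 + Ma)‖ * P := by
    rw [norm_mul, Complex.norm_real, Real.norm_of_nonneg hP]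
  have e5 : ‖X5‖ = ‖Wb - Mb‖ * P := by
    rw [norm_mul, Complex.norm_conj, Complex.norm_real, Real.norm_of_nonneg hP]
  have e6 : ‖X6‖ = ‖Ma + conj Mb - 2 * (A : ℂ) * E2‖ * P := by
    rw [norm_mul, Complex.norm_real, Real.norm_of_nonneg hP]
  have hC := abs_mul_div_succ_le'' C hη
  have hCa : C * Ea ≤ η * P := by
    calc C * Ea ≤ |C| * Ea := mul_le_mul_of_nonneg_right (le_abs_self C) hEa
      _ ≤ |C| * (η / (|C| + 1) * P) := mul_le_mul_of_nonneg_left hEa' (abs_nonneg C)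
      _ = |C| * (η / (|C| + 1)) * P := by ring
      _ ≤ η * P := mul_le_mul_of_nonneg_right hC hP
  have hCb : C * Eb ≤ η * P := by
    calc C * Eb ≤ |C| * Eb := mul_le_mul_of_nonneg_right (le_abs_self C) hEb
      _ ≤ |C| * (η / (|C| + 1) * P) := mul_le_mul_of_nonneg_left hEb' (abs_nonneg C)
      _ = |C| * (η / (|C| + 1)) * P := by ring
      _ ≤ η * P := mul_le_mul_of_nonneg_right hC hP
  have hwP : η * P ≤ η * w * P := by nlinarith [mul_nonneg hη hP]
  have b4 : ‖X4‖ ≤ η * w * P := by rw [e4]; exact mul_le_mul_of_nonneg_right c3 hP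
  have b5 : ‖X5‖ ≤ η * w * P := by rw [e5]; exact mul_le_mul_of_nonneg_right c4 hP
  have b6 : ‖X6‖ ≤ (κ * A + η * w) * P := by rw [e6]; exact mul_le_mul_of_nonneg_right win hP
  nlinarith [r, t1, t2, e3, b4, b5, b6, n1, n2, n3, n4, n5, hCa, hCb, hwP]

end Bookkeeping

/-! ## The two weighted sums from the range claims -/

section Weighted

variable (c' : ℝ)

/-- **(12.15)-shape, generic in the top-range main term**: from (12.12) (`Eq1212`, second form), the middle
range (`Mid1225`) and ANY top-range evaluation `‖S_j(𝐚₁₂,𝐚₂₅)|_{P″₁<dr<P₂} − M₂₅(j)‖ ≤ εα`, the weighted sum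
`(2α)⁻¹S₁ + 2α⁻¹S₂ + (3/2α)S₃` of `(𝐚₁₂,𝐚₂₅)` equals `𝔞e₁* + Σ_j (w_j/α)M₂₅(j)` within `ε`, eventually — the
`e₁*`-part by the EXACT `β`-algebra of (2.13) (`Sec12D.weighted_main1212_eq`; remainder `O(𝔞𝓛⁻⁸) = o(1)` by
`𝔞 ≤ (96e⁹/π²)𝓛⁴`). [cite: Zhang2022LandauSiegel, §12 (12.15) p.72, tex L3660] -/
theorem weighted1225_of_top (M : ∀ D : ℕ, DirichletCharacter ℂ D → ℕ → ℂ)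
    (h1212 : Eq1212 c') (hMid : Mid1225 c')
    (hTop : ∀ ε : ℝ, 0 < ε → ForAllLarge fun D _ χ => AssumptionA D χ →
      ∀ a25 : ℕ → ℂ, (∀ n, a25 n = conj (χ (n : ZMod D) * vk13 D n)) →
        ∀ j ∈ ({1, 2, 3} : Finset ℕ), ‖SjOn c' D j (a12 χ) a25 (rngTop D) - M D χ j‖ ≤ ε * alpha D) :
    ∀ ε : ℝ, 0 < ε → ForAllLarge fun D _ χ => AssumptionA D χ →
      ∀ a25 : ℕ → ℂ, (∀ n, a25 n = conj (χ (n : ZMod D) * vk13 D n)) →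
        ‖(1 / (2 * alpha D) * Sj c' D 1 (a12 χ) a25 + 2 / alpha D * Sj c' D 2 (a12 χ) a25 +
              3 / (2 * alpha D) * Sj c' D 3 (a12 χ) a25 : ℂ) -
            (frakA χ * e1star + (1 / (2 * alpha D) * M D χ 1 + 2 / alpha D * M D χ 2 +
              3 / (2 * alpha D) * M D χ 3))‖ ≤ ε := by
  intro ε hε
  set K₁ : ℝ := ‖bstar‖ * π * (3 * (|c'| * π) * ‖estar1j 1‖ + (36 + 30 * (|c'| * π)) * ‖estar1j 2‖ +
    (12 + 15 * (|c'| * π)) * ‖estar1j 3‖) with hK₁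
  set A₀ : ℝ := 96 * Real.exp 9 / π ^ 2 with hA₀
  have hπ := Real.pi_pos
  have hK₁0 : 0 ≤ K₁ := by positivity
  have hε₁0 : 0 < ε / 24 := by positivity
  obtain ⟨D₀, hall⟩ := (((h1212 (ε / 24) hε₁0).and (hMid (ε / 24) hε₁0)).and (hTop (ε / 24) hε₁0)).and
    (forAllLarge_log_ge (max 4 (2 * A₀ * (|c'| * π) * K₁ / ε + 1)))
  refine ⟨D₀, fun D _ χ hD hq hp hA a25 ha25 => ?_⟩
  obtain ⟨⟨⟨e1212, eMid⟩, eTop⟩, hlog⟩ := hall D χ hD hq hp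
  have hlog4 : 4 ≤ Real.log D := le_trans (le_max_left _ _) hlog
  have hlogK : 2 * A₀ * (|c'| * π) * K₁ / ε + 1 ≤ Real.log D := le_trans (le_max_right _ _) hlog
  have hD1 : 1 ≤ Real.log D := by linarith
  have hℓ1 : 1 ≤ ell D := by rw [ell]; exact hD1
  have hα := alpha_pos_of_log (D := D) hD1
  have hAf := frakA_nonneg χ
  -- the nine range inequalities at `ε/24`
  have r1L := (e1212 hA a25 ha25 1 (by simp)).2
  have r2L := (e1212 hA a25 ha25 2 (by simp)).2
  have r3L := (e1212 hA a25 ha25 3 (by simp)).2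
  have r1M := eMid hA a25 ha25 1 (by simp)
  have r2M := eMid hA a25 ha25 2 (by simp)
  have r3M := eMid hA a25 ha25 3 (by simp)
  have r1T := eTop hA a25 ha25 1 (by simp)
  have r2T := eTop hA a25 ha25 2 (by simp)
  have r3T := eTop hA a25 ha25 3 (by simp)
  -- the weighted sum
  have W := weighted_sum_top hα (Sj_a12_split c' χ hlog4 1 a25) (Sj_a12_split c' χ hlog4 2 a25)
    (Sj_a12_split c' χ hlog4 3 a25) r1L r1M r1T r2L r2M r2T r3L r3M r3T
    (weighted_main1212_eq c' χ hD1)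
  -- the remainder is `o(1)`
  have hxabs : |c' * alpha D * ell D| ≤ |c'| * π := abs_pert_le c' hD1
  have hxeq : |c' * alpha D * ell D| = |c'| * (π * (ell D ^ 8)⁻¹) := by
    rw [mul_assoc, abs_mul, abs_of_nonneg (mul_nonneg hα.le (by linarith)), alpha_mul_ell_eq hD1]
  have hR := norm_beta_remainder_le (A := frakA χ) hAf hxabs
  rw [hxeq] at hR
  have hRs : frakA χ * (|c'| * (π * (ell D ^ 8)⁻¹)) * K₁ ≤ ε / 2 := by
    have := remainder_small (A := frakA χ) (A₀ := A₀) (c := |c'| * π) (K := K₁) hℓ1 hAf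
      (frakA_le_ell_pow_four χ (by linarith) hp) (by positivity) hK₁0 hε (by rw [ell]; linarith)
    simpa [mul_assoc] using this
  refine W.trans ?_
  linarith

/-- **(12.16)-shape, generic in the top-range main term**: from "the first sum contributes `o(α)`" (`Low1522`)
and ANY top-range evaluation `‖S_j(𝐚₁₅,𝐚₂₂)|_{P″₁<dr<P₂} − M₂₂(j)‖ ≤ εα`, the weighted sum
`(2α)⁻¹S₁ + 2α⁻¹S₂ + (3/2α)S₃` of `(𝐚₁₅,𝐚₂₂)` equals `Σ_j (w_j/α)M₂₂(j)` within `ε`, eventually.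
[cite: Zhang2022LandauSiegel, §12 (12.16) p.73, tex L3710] -/
theorem weighted1522_of_top (M : ∀ D : ℕ, DirichletCharacter ℂ D → ℕ → ℂ) (hLow : Low1522 c')
    (hTop : ∀ ε : ℝ, 0 < ε → ForAllLarge fun D _ χ => AssumptionA D χ →
      ∀ a15 : ℕ → ℂ, (∀ n, a15 n = χ (n : ZMod D) * vk13 D n) →
        ∀ j ∈ ({1, 2, 3} : Finset ℕ), ‖SjOn c' D j a15 (a22 χ) (rngTop D) - M D χ j‖ ≤ ε * alpha D) :
    ∀ ε : ℝ, 0 < ε → ForAllLarge fun D _ χ => AssumptionA D χ →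
      ∀ a15 : ℕ → ℂ, (∀ n, a15 n = χ (n : ZMod D) * vk13 D n) →
        ‖(1 / (2 * alpha D) * Sj c' D 1 a15 (a22 χ) + 2 / alpha D * Sj c' D 2 a15 (a22 χ) +
              3 / (2 * alpha D) * Sj c' D 3 a15 (a22 χ) : ℂ) -
            (1 / (2 * alpha D) * M D χ 1 + 2 / alpha D * M D χ 2 + 3 / (2 * alpha D) * M D χ 3)‖ ≤ ε := by
  intro ε hε
  have hε₁0 : 0 < ε / 12 := by positivity
  obtain ⟨D₀, hall⟩ := ((hLow (ε / 12) hε₁0).and (hTop (ε / 12) hε₁0)).and (forAllLarge_log_ge 4)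
  refine ⟨D₀, fun D _ χ hD hq hp hA a15 ha15 => ?_⟩
  obtain ⟨⟨eLow, eTop⟩, hlog4⟩ := hall D χ hD hq hp
  have hD1 : 1 ≤ Real.log D := by linarith
  have hα := alpha_pos_of_log (D := D) hD1
  have r1L := eLow hA a15 ha15 1 (by simp)
  have r2L := eLow hA a15 ha15 2 (by simp)
  have r3L := eLow hA a15 ha15 3 (by simp)
  have r1T := eTop hA a15 ha15 1 (by simp)
  have r2T := eTop hA a15 ha15 2 (by simp)
  have r3T := eTop hA a15 ha15 3 (by simp)
  have hz : ‖(0 : ℂ)‖ ≤ ε / 12 * alpha D := by rw [norm_zero]; positivity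
  have split : ∀ j : ℕ, Sj c' D j a15 (a22 χ) =
      SjOn c' D j a15 (a22 χ) (rngBot D) + 0 + SjOn c' D j a15 (a22 χ) (rngTop D) := fun j => by
    rw [Sj_a15_split c' χ hlog4 j a15]; ring
  have W := weighted_sum_top hα (m1 := 0) (m2 := 0) (m3 := 0) (E1 := 0) (R := 0)
    (split 1) (split 2) (split 3)
    (by rw [sub_zero]; exact r1L) hz r1T (by rw [sub_zero]; exact r2L) hz r2T
    (by rw [sub_zero]; exact r3L) hz r3T (by ring)
  rw [norm_zero, zero_add] at W
  refine W.trans ?_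
  linarith

end Weighted

/-! ## The error terms `E(𝐚₁₂,𝐚₂₅)`, `E(𝐚₁₅,𝐚₂₂)` of Proposition 7.1 are `o(𝔓)` -/

section ErrorTerms

variable (c' : ℝ) {D : ℕ} [NeZero D] (χ : DirichletCharacter ℂ D)

/-- **`S_j(𝐚₁₂,𝐚₂₅) = O(α(𝔞+1))`** from the three range claims at `ε = 1` and a size bound `‖M‖ ≤ Kα(𝔞+1)` on the
top-range main term: `‖S_j‖ ≤ α(𝔞(K₁ⱼ + K) + (3 + K))`, `K₁ⱼ = ‖b*‖9π(1+5|c′|π)²‖e*_{1j}‖`.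
[cite: Zhang2022LandauSiegel, §12 (12.12)–(12.13) pp.71–72] -/
theorem norm_Sj_a12_le_of_top (hD : 4 ≤ Real.log D) (j : ℕ) (a25 : ℕ → ℂ) {m : ℂ} {K : ℝ}
    (hLow : ‖SjOn c' D j (a12 χ) a25 (rngLow D) - main1212int c' χ j‖ ≤ 1 * alpha D)
    (hMid : ‖SjOn c' D j (a12 χ) a25 (rngMid D)‖ ≤ 1 * alpha D)
    (hTop : ‖SjOn c' D j (a12 χ) a25 (rngTop D) - m‖ ≤ 1 * alpha D)
    (hm : ‖m‖ ≤ K * alpha D * (frakA χ + 1)) :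
    ‖Sj c' D j (a12 χ) a25‖ ≤ alpha D * (frakA χ *
      (‖bstar‖ * (9 * π * (1 + 5 * |c'| * π) ^ 2) * ‖estar1j j‖ + K) + (3 + K)) := by
  have hD1 : 1 ≤ Real.log D := by linarith
  have h12 := norm_main1212int_le c' χ hD1 j
  rw [Sj_a12_split c' χ hD j a25]
  set L := SjOn c' D j (a12 χ) a25 (rngLow D)
  set Mi := SjOn c' D j (a12 χ) a25 (rngMid D)
  set T := SjOn c' D j (a12 χ) a25 (rngTop D)
  set m12 := main1212int c' χ j
  have k1 : ‖L‖ ≤ ‖L - m12‖ + ‖m12‖ := by have := norm_sub_norm_le L m12; linarith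
  have k2 : ‖T‖ ≤ ‖T - m‖ + ‖m‖ := by have := norm_sub_norm_le T m; linarith
  have key : ‖L + Mi + T‖ ≤ ‖L - m12‖ + ‖m12‖ + ‖Mi‖ + (‖T - m‖ + ‖m‖) := by
    have := norm_add₃_le (a := L) (b := Mi) (c := T)
    linarith
  set K₁ := ‖bstar‖ * (9 * π * (1 + 5 * |c'| * π) ^ 2) * ‖estar1j j‖
  have e : alpha D * (frakA χ * (K₁ + K) + (3 + K)) =
      frakA χ * K₁ * alpha D + K * alpha D * (frakA χ + 1) + 3 * alpha D := by ring
  rw [e]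
  linarith [key, h12, hLow, hMid, hTop, k1, k2, hm]

/-- **`S_j(𝐚₁₅,𝐚₂₂) = O(α(𝔞+1))`** from "first sum `o(α)`", the top-range claim at `ε = 1` and a size bound
`‖M‖ ≤ Kα(𝔞+1)`: `‖S_j‖ ≤ α(𝔞K + (2 + K))`. [cite: Zhang2022LandauSiegel, §12 (12.16) p.73] -/
theorem norm_Sj_a15_le_of_top (hD : 4 ≤ Real.log D) (j : ℕ) (a15 : ℕ → ℂ) {m : ℂ} {K : ℝ}
    (hBot : ‖SjOn c' D j a15 (a22 χ) (rngBot D)‖ ≤ 1 * alpha D)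
    (hTop : ‖SjOn c' D j a15 (a22 χ) (rngTop D) - m‖ ≤ 1 * alpha D)
    (hm : ‖m‖ ≤ K * alpha D * (frakA χ + 1)) :
    ‖Sj c' D j a15 (a22 χ)‖ ≤ alpha D * (frakA χ * K + (2 + K)) := by
  rw [Sj_a15_split c' χ hD j a15]
  set B := SjOn c' D j a15 (a22 χ) (rngBot D)
  set T := SjOn c' D j a15 (a22 χ) (rngTop D)
  have k2 : ‖T‖ ≤ ‖T - m‖ + ‖m‖ := by have := norm_sub_norm_le T m; linarith
  have key : ‖B + T‖ ≤ ‖B‖ + (‖T - m‖ + ‖m‖) := (norm_add_le _ _).trans (by linarith)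
  have e : alpha D * (frakA χ * K + (2 + K)) = K * alpha D * (frakA χ + 1) + 2 * alpha D := by ring
  rw [e]
  linarith [key, hBot, hTop, k2, hm]

/-- **`E(𝐚₁₂,𝐚₂₅) = o(𝔓)`, generic in the top-range main term** — the TACIT input of "by Proposition 7.1" at
(12.17), from (12.12), the middle range, ANY top-range evaluation with main term `M₂₅` and a size bound
`‖M₂₅(j)‖ ≤ Kα(𝔞+1)` (so `S_j = O(α(𝔞+1))`, `𝔞 ≪ 𝓛⁴`, `α𝓛² = π𝓛⁻⁷`; pattern `Sec12D.ecal_a12_small`).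
[cite: Zhang2022LandauSiegel, §12 (12.17) p.73; §7 Prop. 7.1] -/
theorem ecal_a12_small_of_top (M : ∀ D : ℕ, DirichletCharacter ℂ D → ℕ → ℂ)
    (h1212 : Eq1212 c') (hMid : Mid1225 c')
    (hTop : ∀ ε : ℝ, 0 < ε → ForAllLarge fun D _ χ => AssumptionA D χ →
      ∀ a25 : ℕ → ℂ, (∀ n, a25 n = conj (χ (n : ZMod D) * vk13 D n)) →
        ∀ j ∈ ({1, 2, 3} : Finset ℕ), ‖SjOn c' D j (a12 χ) a25 (rngTop D) - M D χ j‖ ≤ ε * alpha D)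
    (hB : ∃ K : ℝ, ForAllLarge fun D _ χ => AssumptionA D χ →
      ∀ j ∈ ({1, 2, 3} : Finset ℕ), ‖M D χ j‖ ≤ K * alpha D * (frakA χ + 1)) :
    ∀ ε : ℝ, 0 < ε → ForAllLarge fun D _ χ => AssumptionA D χ →
      Ecal c' D (a12 χ) (a25 χ) ≤ ε * frakP D := by
  intro ε hε
  obtain ⟨K, hBK⟩ := hB
  set K' := max K 0 with hK'
  have hK'0 : 0 ≤ K' := le_max_right _ _
  set Kj : ℕ → ℝ := fun j => ‖bstar‖ * (9 * π * (1 + 5 * |c'| * π) ^ 2) * ‖estar1j j‖ + K'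
    with hKj
  set Kt := Kj 1 + Kj 2 + Kj 3 with hKt
  set c₀ := 3 * (3 + K') with hc₀
  set A₀ : ℝ := 96 * Real.exp 9 / π ^ 2 with hA₀
  have hπ := Real.pi_pos
  have hKj0 : ∀ j, 0 ≤ Kj j := fun j => by positivity
  have hKt0 : 0 ≤ Kt := by positivity
  have hc₀0 : 0 ≤ c₀ := by positivity
  have hA₀0 : 0 ≤ A₀ := by positivity
  obtain ⟨D₀, hall⟩ := ((((h1212 1 one_pos).and (hMid 1 one_pos)).and (hTop 1 one_pos)).and hBK).and
    (forAllLarge_log_ge (max 4 (π * (A₀ * Kt + c₀) / ε)))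
  refine ⟨D₀, fun D _ χ hD hq hp hA => ?_⟩
  obtain ⟨⟨⟨⟨e1212, eMid⟩, eTop⟩, eB⟩, hlog⟩ := hall D χ hD hq hp
  have hlog4 : 4 ≤ Real.log D := le_trans (le_max_left _ _) hlog
  have hlogb : π * (A₀ * Kt + c₀) / ε ≤ Real.log D := le_trans (le_max_right _ _) hlog
  have hD1 : 1 ≤ Real.log D := by linarith
  have hα := (alpha_pos_of_log hD1).le
  have hAf := frakA_nonneg χ
  have ha25 : ∀ n, a25 χ n = conj (χ (n : ZMod D) * vk13 D n) := fun n => rfl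
  -- the three `S_j`
  have hS : ∀ j ∈ ({1, 2, 3} : Finset ℕ), ‖Sj c' D j (a12 χ) (a25 χ)‖ ≤
      alpha D * (frakA χ * Kj j + (3 + K')) := by
    intro j hj
    have h1 := (e1212 hA (a25 χ) ha25 j hj).2
    have h2 := eMid hA (a25 χ) ha25 j hj
    have h3 := eTop hA (a25 χ) ha25 j hj
    have h4 : ‖M D χ j‖ ≤ K' * alpha D * (frakA χ + 1) :=
      (eB hA j hj).trans (by gcongr; exact le_max_left _ _)
    exact norm_Sj_a12_le_of_top c' χ hlog4 j (a25 χ) h1 h2 h3 h4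
  have hS1 := hS 1 (by simp)
  have hS2 := hS 2 (by simp)
  have hS3 := hS 3 (by simp)
  have hP := frakP_nonneg D
  have hℓ1 : 1 ≤ ell D := by rw [ell]; exact hD1
  have hsum : ‖Sj c' D 1 (a12 χ) (a25 χ)‖ + ‖Sj c' D 2 (a12 χ) (a25 χ)‖ + ‖Sj c' D 3 (a12 χ) (a25 χ)‖
      ≤ alpha D * (frakA χ * Kt + c₀) := by
    rw [hKt, hc₀]; nlinarith
  have hαℓ : alpha D * ell D ^ 2 = π / ell D ^ 7 := by
    have hℓ0 : ell D ≠ 0 := by linarith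
    rw [Section2.alpha_eq_pi_div_ell9]; field_simp
  have hsmall : π / ell D ^ 7 * (frakA χ * Kt + c₀) ≤ ε :=
    small_of_log_large' hℓ1 hKt0 hc₀0 hA₀0 (frakA_le_ell_pow_four χ (by linarith) hp) hε
      (by rw [ell]; exact hlogb)
  rw [Ecal]
  calc frakP D * ell D ^ 2 *
        (‖Sj c' D 1 (a12 χ) (a25 χ)‖ + ‖Sj c' D 2 (a12 χ) (a25 χ)‖ + ‖Sj c' D 3 (a12 χ) (a25 χ)‖)
      ≤ frakP D * ell D ^ 2 * (alpha D * (frakA χ * Kt + c₀)) := by gcongr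
    _ = frakP D * (π / ell D ^ 7 * (frakA χ * Kt + c₀)) := by rw [← hαℓ]; ring
    _ ≤ frakP D * ε := by gcongr
    _ = ε * frakP D := by ring

/-- **`E(𝐚₁₅,𝐚₂₂) = o(𝔓)`, generic in the top-range main term** — from "first sum `o(α)`" (`Low1522`), ANY
top-range evaluation with main term `M₂₂` and a size bound `‖M₂₂(j)‖ ≤ Kα(𝔞+1)` (pattern
`Sec12D.ecal_a15_small`). [cite: Zhang2022LandauSiegel, §12 (12.17) p.73; §7 Prop. 7.1] -/
theorem ecal_a15_small_of_top (M : ∀ D : ℕ, DirichletCharacter ℂ D → ℕ → ℂ) (hLow : Low1522 c')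
    (hTop : ∀ ε : ℝ, 0 < ε → ForAllLarge fun D _ χ => AssumptionA D χ →
      ∀ a15 : ℕ → ℂ, (∀ n, a15 n = χ (n : ZMod D) * vk13 D n) →
        ∀ j ∈ ({1, 2, 3} : Finset ℕ), ‖SjOn c' D j a15 (a22 χ) (rngTop D) - M D χ j‖ ≤ ε * alpha D)
    (hB : ∃ K : ℝ, ForAllLarge fun D _ χ => AssumptionA D χ →
      ∀ j ∈ ({1, 2, 3} : Finset ℕ), ‖M D χ j‖ ≤ K * alpha D * (frakA χ + 1)) :
    ∀ ε : ℝ, 0 < ε → ForAllLarge fun D _ χ => AssumptionA D χ →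
      Ecal c' D (a15 χ) (a22 χ) ≤ ε * frakP D := by
  intro ε hε
  obtain ⟨K, hBK⟩ := hB
  set K' := max K 0 with hK'
  have hK'0 : 0 ≤ K' := le_max_right _ _
  set Kt := 3 * K' with hKt
  set c₀ := 3 * (2 + K') with hc₀
  set A₀ : ℝ := 96 * Real.exp 9 / π ^ 2 with hA₀
  have hπ := Real.pi_pos
  have hKt0 : 0 ≤ Kt := by positivity
  have hc₀0 : 0 ≤ c₀ := by positivity
  have hA₀0 : 0 ≤ A₀ := by positivity
  obtain ⟨D₀, hall⟩ := (((hLow 1 one_pos).and (hTop 1 one_pos)).and hBK).and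
    (forAllLarge_log_ge (max 4 (π * (A₀ * Kt + c₀) / ε)))
  refine ⟨D₀, fun D _ χ hD hq hp hA => ?_⟩
  obtain ⟨⟨⟨eLow, eTop⟩, eB⟩, hlog⟩ := hall D χ hD hq hp
  have hlog4 : 4 ≤ Real.log D := le_trans (le_max_left _ _) hlog
  have hlogb : π * (A₀ * Kt + c₀) / ε ≤ Real.log D := le_trans (le_max_right _ _) hlog
  have hD1 : 1 ≤ Real.log D := by linarith
  have hα := (alpha_pos_of_log hD1).le
  have hAf := frakA_nonneg χ
  have ha15 : ∀ n, a15 χ n = χ (n : ZMod D) * vk13 D n := fun n => rfl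
  have hS : ∀ j ∈ ({1, 2, 3} : Finset ℕ), ‖Sj c' D j (a15 χ) (a22 χ)‖ ≤
      alpha D * (frakA χ * K' + (2 + K')) := by
    intro j hj
    have h1 := eLow hA (a15 χ) ha15 j hj
    have h2 := eTop hA (a15 χ) ha15 j hj
    have h4 : ‖M D χ j‖ ≤ K' * alpha D * (frakA χ + 1) :=
      (eB hA j hj).trans (by gcongr; exact le_max_left _ _)
    exact norm_Sj_a15_le_of_top c' χ hlog4 j (a15 χ) h1 h2 h4
  have hS1 := hS 1 (by simp)
  have hS2 := hS 2 (by simp)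
  have hS3 := hS 3 (by simp)
  have hP := frakP_nonneg D
  have hℓ1 : 1 ≤ ell D := by rw [ell]; exact hD1
  have hsum : ‖Sj c' D 1 (a15 χ) (a22 χ)‖ + ‖Sj c' D 2 (a15 χ) (a22 χ)‖ + ‖Sj c' D 3 (a15 χ) (a22 χ)‖
      ≤ alpha D * (frakA χ * Kt + c₀) := by
    rw [hKt, hc₀]; nlinarith
  have hαℓ : alpha D * ell D ^ 2 = π / ell D ^ 7 := by
    have hℓ0 : ell D ≠ 0 := by linarith
    rw [Section2.alpha_eq_pi_div_ell9]; field_simp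
  have hsmall : π / ell D ^ 7 * (frakA χ * Kt + c₀) ≤ ε :=
    small_of_log_large' hℓ1 hKt0 hc₀0 hA₀0 (frakA_le_ell_pow_four χ (by linarith) hp) hε
      (by rw [ell]; exact hlogb)
  rw [Ecal]
  calc frakP D * ell D ^ 2 *
        (‖Sj c' D 1 (a15 χ) (a22 χ)‖ + ‖Sj c' D 2 (a15 χ) (a22 χ)‖ + ‖Sj c' D 3 (a15 χ) (a22 χ)‖)
      ≤ frakP D * ell D ^ 2 * (alpha D * (frakA χ * Kt + c₀)) := by gcongr
    _ = frakP D * (π / ell D ^ 7 * (frakA χ * Kt + c₀)) := by rw [← hαℓ]; ring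
    _ ≤ frakP D * ε := by gcongr
    _ = ε * frakP D := by ring

end ErrorTerms

/-! ## The assembler, in both currencies -/

section Assembly

variable (c' : ℝ)

/-- **(12.17) from the range evaluations, generic in the top-range main terms (absolute currency, R-18):**
Proposition 7.1 (`Prop71`), (12.9) (`Eq129`), (12.12) (`Eq1212`), the middle range (`Mid1225`), a top-range
evaluation of `S_j(𝐚₁₂,𝐚₂₅)` with main term `M₂₅`, "first sum `o(α)`" (`Low1522`), a top-range evaluation of
`S_j(𝐚₁₅,𝐚₂₂)` with main term `M₂₂`, size bounds `‖M(j)‖ ≤ Kα(𝔞+1)` and the WINDOW VALUE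
`‖Σ_j (w_j/α)M₂₅(j) + conj(Σ_j (w_j/α)M₂₂(j)) − 2𝔞e₂*‖ ≤ κ𝔞 + ε` with `κ ≤ 10⁻⁵` give
`Skeleton.Eval1217 c′`: `‖Ξ₁₅ − (e₁* + 2e₂*)𝔞𝔓‖ ≤ 10⁻⁵𝔞𝔓 + ε𝔓` eventually — "Finally, by (12.9), (12.15) and (12.16)
we conclude (12.17)" (p. 73, tex L3713), the tacit `E(·,·) = o(𝔓)` derived. At `M₂₅ = main1213intEx`,
`M₂₂ = main12u049intEx`, `κ = 5·10⁻⁶` this is the typed `Typed.Sec12C.DedEval1217Ex` (companion file).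
[cite: Zhang2022LandauSiegel, §12 (12.17) p.73] -/
theorem eval1217_of_top_ranges (M25 M22 : ∀ D : ℕ, DirichletCharacter ℂ D → ℕ → ℂ) {κ : ℝ}
    (hκ : κ ≤ 1e-5) (h71 : Prop71 c') (h129 : Eq129 c') (h1212 : Eq1212 c') (hMid : Mid1225 c')
    (hTop25 : ∀ ε : ℝ, 0 < ε → ForAllLarge fun D _ χ => AssumptionA D χ →
      ∀ a25 : ℕ → ℂ, (∀ n, a25 n = conj (χ (n : ZMod D) * vk13 D n)) →
        ∀ j ∈ ({1, 2, 3} : Finset ℕ), ‖SjOn c' D j (a12 χ) a25 (rngTop D) - M25 D χ j‖ ≤ ε * alpha D)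
    (hLow : Low1522 c')
    (hTop22 : ∀ ε : ℝ, 0 < ε → ForAllLarge fun D _ χ => AssumptionA D χ →
      ∀ a15 : ℕ → ℂ, (∀ n, a15 n = χ (n : ZMod D) * vk13 D n) →
        ∀ j ∈ ({1, 2, 3} : Finset ℕ), ‖SjOn c' D j a15 (a22 χ) (rngTop D) - M22 D χ j‖ ≤ ε * alpha D)
    (hB25 : ∃ K : ℝ, ForAllLarge fun D _ χ => AssumptionA D χ →
      ∀ j ∈ ({1, 2, 3} : Finset ℕ), ‖M25 D χ j‖ ≤ K * alpha D * (frakA χ + 1))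
    (hB22 : ∃ K : ℝ, ForAllLarge fun D _ χ => AssumptionA D χ →
      ∀ j ∈ ({1, 2, 3} : Finset ℕ), ‖M22 D χ j‖ ≤ K * alpha D * (frakA χ + 1))
    (hWin : ∀ ε : ℝ, 0 < ε → ForAllLarge fun D _ χ => AssumptionA D χ →
      ‖(1 / (2 * alpha D) * M25 D χ 1 + 2 / alpha D * M25 D χ 2 + 3 / (2 * alpha D) * M25 D χ 3 +
            conj (1 / (2 * alpha D) * M22 D χ 1 + 2 / alpha D * M22 D χ 2 +
              3 / (2 * alpha D) * M22 D χ 3) : ℂ) - 2 * frakA χ * e2star‖ ≤ κ * frakA χ + ε) :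
    Eval1217 c' := by
  have hW25 := weighted1225_of_top c' M25 h1212 hMid hTop25
  have hW22 := weighted1522_of_top c' M22 hLow hTop22
  have hE1 := ecal_a12_small_of_top c' M25 h1212 hMid hTop25 hB25
  have hE2 := ecal_a15_small_of_top c' M22 hLow hTop22 hB22
  intro ε hε
  set η := ε / 8 with hη
  have hη0 : 0 < η := by positivity
  set B := max (‖iota3‖ + ‖iota4‖) 1 with hB
  obtain ⟨C, h71'⟩ := h71 B η hη0
  have hC1 : 0 < |C| + 1 := by positivity
  obtain ⟨D₀, hall⟩ := ((((((h71'.and (h129 η hη0)).and (hW25 η hη0)).and (hW22 η hη0)).and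
    (hWin η hη0)).and ((hE1 (η / (|C| + 1)) (by positivity)).and (hE2 (η / (|C| + 1)) (by positivity)))).and
    (forAllLarge_log_ge 4))
  refine ⟨D₀, fun D _ χ hD hq hp hA => ?_⟩
  obtain ⟨⟨⟨⟨⟨⟨h71D, h129D⟩, hW25D⟩, hW22D⟩, hWinD⟩, ⟨hE1D, hE2D⟩⟩, hlog4⟩ := hall D χ hD hq hp
  have hlog2 : 2 ≤ Real.log D := by linarith
  have hlog3 : 3 ≤ Real.log D := by linarith
  have hD1 : 1 ≤ Real.log D := by linarith
  have hP := frakP_nonneg D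
  have hAf := frakA_nonneg χ
  -- admissibility (7.2) of the four sequences, with the common bound `B`
  have adm12 : Adm72 D B (a12 χ) := adm72_mono (le_max_left _ _) (adm72_a12 χ hlog2)
  have adm22 : Adm72 D B (a22 χ) := adm72_mono (le_max_left _ _) (adm72_a22 χ hlog2)
  have adm25 : Adm72 D B (a25 χ) := adm72_mono (le_max_right _ _) (adm72_a25 χ hlog3)
  have adm15 : Adm72 D B (a15 χ) := adm72_mono (le_max_right _ _) (adm72_a15 χ hlog3)
  -- Proposition 7.1 at the two pairs
  have t1 := h71D hA (a12 χ) (a25 χ) adm12 adm25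
  have t2 := h71D hA (a15 χ) (a22 χ) adm15 adm22
  -- the two weighted sums and the window value
  have w1 := hW25D hA (a25 χ) (fun n => rfl)
  have w2 := hW22D hA (a15 χ) (fun n => rfl)
  have win := hWinD hA
  -- the error terms
  have E1 := hE1D hA
  have E2 := hE2D hA
  have hEnn : ∀ a₁ a₂ : ℕ → ℂ, 0 ≤ Ecal c' D a₁ a₂ := fun a₁ a₂ => by
    unfold Ecal; exact mul_nonneg (mul_nonneg hP (sq_nonneg _)) (by positivity)
  have r := h129D hA
  have key := xi15_assembly_pt (w := 1) (κ := κ) (A := frakA χ) hP le_rfl hη0.le (hEnn _ _) (hEnn _ _)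
    (by simpa using r) t1 (mainMV_eq_weighted c' hD1 (a12 χ) (a25 χ)) E1
    t2 (mainMV_eq_weighted c' hD1 (a15 χ) (a22 χ)) E2
    (by simpa using w1) (by simpa using w2) (by simpa using win)
  have hAP : 0 ≤ frakA χ * frakP D := mul_nonneg hAf hP
  calc ‖xi15 c' χ - (e1star + 2 * e2star) * frakA χ * frakP D‖
      ≤ κ * frakA χ * frakP D + 8 * η * 1 * frakP D := key
    _ ≤ 1e-5 * frakA χ * frakP D + ε * frakP D := by
        rw [hη]
        nlinarith [mul_le_mul_of_nonneg_right hκ hAP]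

/-- **(12.17)ᴿ from the range evaluations, generic in the top-range main terms (RELATIVE currency of record,
R-25):** as `eval1217_of_top_ranges`, but with (12.9) in the relative reading
`‖Ξ₁₅ − (Θ₁(𝐚₁₂,𝐚₂₅) + conj Θ₁(𝐚₁₅,𝐚₂₂))‖ ≤ ε(𝔞+1)𝔓` (as supplied from (12.6), (12.8) by
`Sec12D.eq129_rel_of_xi15_rel ∘ xi15Hbar16_rel_of_eq126_eq128`) and the window value within `κ𝔞 + ε(𝔞+1)`;
conclusion `Skeleton.Eval1217Rel c′`: `‖Ξ₁₅ − (e₁* + 2e₂*)𝔞𝔓‖ ≤ 10⁻⁵𝔞𝔓 + ε(𝔞+1)𝔓` eventually.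
[cite: Zhang2022LandauSiegel, §12 (12.17) p.73] -/
theorem eval1217Rel_of_top_ranges (M25 M22 : ∀ D : ℕ, DirichletCharacter ℂ D → ℕ → ℂ) {κ : ℝ}
    (hκ : κ ≤ 1e-5) (h71 : Prop71 c')
    (h129 : ∀ ε : ℝ, 0 < ε → ForAllLarge fun D _ χ => AssumptionA D χ →
      ‖xi15 c' χ - (Theta1 c' χ (a12 χ) (a25 χ) + conj (Theta1 c' χ (a15 χ) (a22 χ)))‖ ≤
        ε * (frakA χ + 1) * frakP D)
    (h1212 : Eq1212 c') (hMid : Mid1225 c')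
    (hTop25 : ∀ ε : ℝ, 0 < ε → ForAllLarge fun D _ χ => AssumptionA D χ →
      ∀ a25 : ℕ → ℂ, (∀ n, a25 n = conj (χ (n : ZMod D) * vk13 D n)) →
        ∀ j ∈ ({1, 2, 3} : Finset ℕ), ‖SjOn c' D j (a12 χ) a25 (rngTop D) - M25 D χ j‖ ≤ ε * alpha D)
    (hLow : Low1522 c')
    (hTop22 : ∀ ε : ℝ, 0 < ε → ForAllLarge fun D _ χ => AssumptionA D χ →
      ∀ a15 : ℕ → ℂ, (∀ n, a15 n = χ (n : ZMod D) * vk13 D n) →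
        ∀ j ∈ ({1, 2, 3} : Finset ℕ), ‖SjOn c' D j a15 (a22 χ) (rngTop D) - M22 D χ j‖ ≤ ε * alpha D)
    (hB25 : ∃ K : ℝ, ForAllLarge fun D _ χ => AssumptionA D χ →
      ∀ j ∈ ({1, 2, 3} : Finset ℕ), ‖M25 D χ j‖ ≤ K * alpha D * (frakA χ + 1))
    (hB22 : ∃ K : ℝ, ForAllLarge fun D _ χ => AssumptionA D χ →
      ∀ j ∈ ({1, 2, 3} : Finset ℕ), ‖M22 D χ j‖ ≤ K * alpha D * (frakA χ + 1))
    (hWin : ∀ ε : ℝ, 0 < ε → ForAllLarge fun D _ χ => AssumptionA D χ →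
      ‖(1 / (2 * alpha D) * M25 D χ 1 + 2 / alpha D * M25 D χ 2 + 3 / (2 * alpha D) * M25 D χ 3 +
            conj (1 / (2 * alpha D) * M22 D χ 1 + 2 / alpha D * M22 D χ 2 +
              3 / (2 * alpha D) * M22 D χ 3) : ℂ) - 2 * frakA χ * e2star‖ ≤
          κ * frakA χ + ε * (frakA χ + 1)) :
    Eval1217Rel c' := by
  have hW25 := weighted1225_of_top c' M25 h1212 hMid hTop25
  have hW22 := weighted1522_of_top c' M22 hLow hTop22
  have hE1 := ecal_a12_small_of_top c' M25 h1212 hMid hTop25 hB25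
  have hE2 := ecal_a15_small_of_top c' M22 hLow hTop22 hB22
  intro ε hε
  set η := ε / 8 with hη
  have hη0 : 0 < η := by positivity
  set B := max (‖iota3‖ + ‖iota4‖) 1 with hB
  obtain ⟨C, h71'⟩ := h71 B η hη0
  have hC1 : 0 < |C| + 1 := by positivity
  obtain ⟨D₀, hall⟩ := ((((((h71'.and (h129 η hη0)).and (hW25 η hη0)).and (hW22 η hη0)).and
    (hWin η hη0)).and ((hE1 (η / (|C| + 1)) (by positivity)).and (hE2 (η / (|C| + 1)) (by positivity)))).and
    (forAllLarge_log_ge 4))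
  refine ⟨D₀, fun D _ χ hD hq hp hA => ?_⟩
  obtain ⟨⟨⟨⟨⟨⟨h71D, h129D⟩, hW25D⟩, hW22D⟩, hWinD⟩, ⟨hE1D, hE2D⟩⟩, hlog4⟩ := hall D χ hD hq hp
  have hlog2 : 2 ≤ Real.log D := by linarith
  have hlog3 : 3 ≤ Real.log D := by linarith
  have hD1 : 1 ≤ Real.log D := by linarith
  have hP := frakP_nonneg D
  have hAf := frakA_nonneg χ
  have hw1 : (1 : ℝ) ≤ frakA χ + 1 := by linarith
  have adm12 : Adm72 D B (a12 χ) := adm72_mono (le_max_left _ _) (adm72_a12 χ hlog2)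
  have adm22 : Adm72 D B (a22 χ) := adm72_mono (le_max_left _ _) (adm72_a22 χ hlog2)
  have adm25 : Adm72 D B (a25 χ) := adm72_mono (le_max_right _ _) (adm72_a25 χ hlog3)
  have adm15 : Adm72 D B (a15 χ) := adm72_mono (le_max_right _ _) (adm72_a15 χ hlog3)
  have t1 := h71D hA (a12 χ) (a25 χ) adm12 adm25
  have t2 := h71D hA (a15 χ) (a22 χ) adm15 adm22
  have w1 := hW25D hA (a25 χ) (fun n => rfl)
  have w2 := hW22D hA (a15 χ) (fun n => rfl)
  have win := hWinD hA
  have E1 := hE1D hA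
  have E2 := hE2D hA
  have hEnn : ∀ a₁ a₂ : ℕ → ℂ, 0 ≤ Ecal c' D a₁ a₂ := fun a₁ a₂ => by
    unfold Ecal; exact mul_nonneg (mul_nonneg hP (sq_nonneg _)) (by positivity)
  have r := h129D hA
  have hηw : η ≤ η * (frakA χ + 1) := le_mul_of_one_le_right hη0.le hw1
  have key := xi15_assembly_pt (w := frakA χ + 1) (κ := κ) (A := frakA χ) hP hw1 hη0.le
    (hEnn _ _) (hEnn _ _) r t1 (mainMV_eq_weighted c' hD1 (a12 χ) (a25 χ)) E1
    t2 (mainMV_eq_weighted c' hD1 (a15 χ) (a22 χ)) E2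
    (w1.trans hηw) (w2.trans hηw) win
  have hAP : 0 ≤ frakA χ * frakP D := mul_nonneg hAf hP
  calc ‖xi15 c' χ - (e1star + 2 * e2star) * frakA χ * frakP D‖
      ≤ κ * frakA χ * frakP D + 8 * η * (frakA χ + 1) * frakP D := key
    _ ≤ 1e-5 * frakA χ * frakP D + ε * (frakA χ + 1) * frakP D := by
        rw [hη]
        nlinarith [mul_le_mul_of_nonneg_right hκ hAP]

end Assembly

/-! ## The same assemblers for main-term families that take the `NeZero D` instance

The typed main terms (`Typed.Sec12C.main1213intEx c′ χ j`, …) live under `[NeZero D]`; a family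
`M : (D : ℕ) → [NeZero D] → DirichletCharacter ℂ D → ℕ → ℂ` is reduced to the instance-free shape above by
extending it by `0` at `D = 0` (inside `ForAllLarge` the instance is in scope and the two agree; `NeZero D` is a
`Prop`, so the choice of instance is immaterial). -/

section AssemblyInst

variable (c' : ℝ)

/-- **(12.17) from the range evaluations (absolute currency)** for main-term families taking the `NeZero D`
instance — `eval1217_of_top_ranges` transported along `M ↦ (D ↦ if D = 0 then 0 else M D)`.
[cite: Zhang2022LandauSiegel, §12 (12.17) p.73] -/
theorem eval1217_of_top_ranges' (M25 M22 : ∀ (D : ℕ) [NeZero D], DirichletCharacter ℂ D → ℕ → ℂ) {κ : ℝ}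
    (hκ : κ ≤ 1e-5) (h71 : Prop71 c') (h129 : Eq129 c') (h1212 : Eq1212 c') (hMid : Mid1225 c')
    (hTop25 : ∀ ε : ℝ, 0 < ε → ForAllLarge fun D _ χ => AssumptionA D χ →
      ∀ a25 : ℕ → ℂ, (∀ n, a25 n = conj (χ (n : ZMod D) * vk13 D n)) →
        ∀ j ∈ ({1, 2, 3} : Finset ℕ), ‖SjOn c' D j (a12 χ) a25 (rngTop D) - M25 D χ j‖ ≤ ε * alpha D)
    (hLow : Low1522 c')
    (hTop22 : ∀ ε : ℝ, 0 < ε → ForAllLarge fun D _ χ => AssumptionA D χ →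
      ∀ a15 : ℕ → ℂ, (∀ n, a15 n = χ (n : ZMod D) * vk13 D n) →
        ∀ j ∈ ({1, 2, 3} : Finset ℕ), ‖SjOn c' D j a15 (a22 χ) (rngTop D) - M22 D χ j‖ ≤ ε * alpha D)
    (hB25 : ∃ K : ℝ, ForAllLarge fun D _ χ => AssumptionA D χ →
      ∀ j ∈ ({1, 2, 3} : Finset ℕ), ‖M25 D χ j‖ ≤ K * alpha D * (frakA χ + 1))
    (hB22 : ∃ K : ℝ, ForAllLarge fun D _ χ => AssumptionA D χ →
      ∀ j ∈ ({1, 2, 3} : Finset ℕ), ‖M22 D χ j‖ ≤ K * alpha D * (frakA χ + 1))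
    (hWin : ∀ ε : ℝ, 0 < ε → ForAllLarge fun D _ χ => AssumptionA D χ →
      ‖(1 / (2 * alpha D) * M25 D χ 1 + 2 / alpha D * M25 D χ 2 + 3 / (2 * alpha D) * M25 D χ 3 +
            conj (1 / (2 * alpha D) * M22 D χ 1 + 2 / alpha D * M22 D χ 2 +
              3 / (2 * alpha D) * M22 D χ 3) : ℂ) - 2 * frakA χ * e2star‖ ≤ κ * frakA χ + ε) :
    Eval1217 c' := by
  classical
  set N25 : ∀ D : ℕ, DirichletCharacter ℂ D → ℕ → ℂ :=
    fun D χ j => if h : D = 0 then 0 else @M25 D ⟨h⟩ χ j with hN25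
  set N22 : ∀ D : ℕ, DirichletCharacter ℂ D → ℕ → ℂ :=
    fun D χ j => if h : D = 0 then 0 else @M22 D ⟨h⟩ χ j with hN22
  have key25 : ∀ (D : ℕ) (inst : NeZero D) (χ : DirichletCharacter ℂ D) (j : ℕ),
      @M25 D inst χ j = N25 D χ j := by
    intro D inst χ j
    show @M25 D inst χ j = if h : D = 0 then 0 else @M25 D ⟨h⟩ χ j
    rw [dif_neg (NeZero.ne D)]
  have key22 : ∀ (D : ℕ) (inst : NeZero D) (χ : DirichletCharacter ℂ D) (j : ℕ),
      @M22 D inst χ j = N22 D χ j := by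
    intro D inst χ j
    show @M22 D inst χ j = if h : D = 0 then 0 else @M22 D ⟨h⟩ χ j
    rw [dif_neg (NeZero.ne D)]
  simp only [key25] at hTop25 hB25 hWin
  simp only [key22] at hTop22 hB22 hWin
  exact eval1217_of_top_ranges c' N25 N22 hκ h71 h129 h1212 hMid hTop25 hLow hTop22 hB25 hB22 hWin

/-- **(12.17)ᴿ from the range evaluations (relative currency)** for main-term families taking the `NeZero D`
instance — `eval1217Rel_of_top_ranges` transported along `M ↦ (D ↦ if D = 0 then 0 else M D)`.
[cite: Zhang2022LandauSiegel, §12 (12.17) p.73] -/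
theorem eval1217Rel_of_top_ranges' (M25 M22 : ∀ (D : ℕ) [NeZero D], DirichletCharacter ℂ D → ℕ → ℂ)
    {κ : ℝ} (hκ : κ ≤ 1e-5) (h71 : Prop71 c')
    (h129 : ∀ ε : ℝ, 0 < ε → ForAllLarge fun D _ χ => AssumptionA D χ →
      ‖xi15 c' χ - (Theta1 c' χ (a12 χ) (a25 χ) + conj (Theta1 c' χ (a15 χ) (a22 χ)))‖ ≤
        ε * (frakA χ + 1) * frakP D)
    (h1212 : Eq1212 c') (hMid : Mid1225 c')
    (hTop25 : ∀ ε : ℝ, 0 < ε → ForAllLarge fun D _ χ => AssumptionA D χ →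
      ∀ a25 : ℕ → ℂ, (∀ n, a25 n = conj (χ (n : ZMod D) * vk13 D n)) →
        ∀ j ∈ ({1, 2, 3} : Finset ℕ), ‖SjOn c' D j (a12 χ) a25 (rngTop D) - M25 D χ j‖ ≤ ε * alpha D)
    (hLow : Low1522 c')
    (hTop22 : ∀ ε : ℝ, 0 < ε → ForAllLarge fun D _ χ => AssumptionA D χ →
      ∀ a15 : ℕ → ℂ, (∀ n, a15 n = χ (n : ZMod D) * vk13 D n) →
        ∀ j ∈ ({1, 2, 3} : Finset ℕ), ‖SjOn c' D j a15 (a22 χ) (rngTop D) - M22 D χ j‖ ≤ ε * alpha D)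
    (hB25 : ∃ K : ℝ, ForAllLarge fun D _ χ => AssumptionA D χ →
      ∀ j ∈ ({1, 2, 3} : Finset ℕ), ‖M25 D χ j‖ ≤ K * alpha D * (frakA χ + 1))
    (hB22 : ∃ K : ℝ, ForAllLarge fun D _ χ => AssumptionA D χ →
      ∀ j ∈ ({1, 2, 3} : Finset ℕ), ‖M22 D χ j‖ ≤ K * alpha D * (frakA χ + 1))
    (hWin : ∀ ε : ℝ, 0 < ε → ForAllLarge fun D _ χ => AssumptionA D χ →
      ‖(1 / (2 * alpha D) * M25 D χ 1 + 2 / alpha D * M25 D χ 2 + 3 / (2 * alpha D) * M25 D χ 3 +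
            conj (1 / (2 * alpha D) * M22 D χ 1 + 2 / alpha D * M22 D χ 2 +
              3 / (2 * alpha D) * M22 D χ 3) : ℂ) - 2 * frakA χ * e2star‖ ≤
          κ * frakA χ + ε * (frakA χ + 1)) :
    Eval1217Rel c' := by
  classical
  set N25 : ∀ D : ℕ, DirichletCharacter ℂ D → ℕ → ℂ :=
    fun D χ j => if h : D = 0 then 0 else @M25 D ⟨h⟩ χ j with hN25
  set N22 : ∀ D : ℕ, DirichletCharacter ℂ D → ℕ → ℂ :=
    fun D χ j => if h : D = 0 then 0 else @M22 D ⟨h⟩ χ j with hN22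
  have key25 : ∀ (D : ℕ) (inst : NeZero D) (χ : DirichletCharacter ℂ D) (j : ℕ),
      @M25 D inst χ j = N25 D χ j := by
    intro D inst χ j
    show @M25 D inst χ j = if h : D = 0 then 0 else @M25 D ⟨h⟩ χ j
    rw [dif_neg (NeZero.ne D)]
  have key22 : ∀ (D : ℕ) (inst : NeZero D) (χ : DirichletCharacter ℂ D) (j : ℕ),
      @M22 D inst χ j = N22 D χ j := by
    intro D inst χ j
    show @M22 D inst χ j = if h : D = 0 then 0 else @M22 D ⟨h⟩ χ j
    rw [dif_neg (NeZero.ne D)]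
  simp only [key25] at hTop25 hB25 hWin
  simp only [key22] at hTop22 hB22 hWin
  exact eval1217Rel_of_top_ranges c' N25 N22 hκ h71 h129 h1212 hMid hTop25 hLow hTop22 hB25 hB22 hWin

end AssemblyInst

end Literature.NumberTheory.LFunctions.Zhang2022.Sec12D
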